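import Mathlib
import HarnessLib
import Summits.QuantumAdvantage.QuantumAdvantage.Theorems.SyndeticDialA
import Summits.QuantumAdvantage.QuantumAdvantage.Theorems.LengthDialG
import Summits.QuantumAdvantage.QuantumAdvantage.Theorems.AbsorptionDialB

/-!
# SyndeticDial, part B/2 (§3–§5: the GAP DIAL, the pieces, `closes` BY NAME) — the LENGTH-SET dial on the residual 28401 `AbsorptionDial.MassHiQuasi`
(decomp-qadv · lens-5 «finite/base range ∧ asymptotic regime ∧ bridge» · generation 27 · 2026-08-31)

TARGET (live route item, BY NAME): `Summit.QuantumAdvantage.QuantumAdvantage.Theses.AbsorptionDial.MassHiQuasi`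
(stmt-QuantumAdvantage-28401, the declared RESIDUAL of route AbsorptionDial), kernel-unfolded by the LANDED
`Theorems.LengthDial.massHiQuasi_unfold : MassHiQuasi ↔ (QuarterFloor → QuasiLoss)` (`Iff.rfl`).  Write T for it,
Q for `QuasiLoss` (∃A ∀C: every cut-degree-(log₂ n)^C u-walk strategy wins ≤ (1 − 2^{−(log₂ n)^A})·2ⁿ inputs, p ≥ 5),
X for item 28487 `NoPerfectPolyOdd`.

## THESIS (the dial).  Along WHICH SET OF LENGTHS must hardness be established?  For a reach `f : ℕ → ℕ`:
* `S_f` (`SyndPiece f`): under the quarter floor, for every prime p ≥ 5, ∃A ∀C, for all large n SOME length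
  m ∈ [n − f(n), n] is hard at scale n (all charges, degree (log₂ n)^C, value 1 − 2^{−(log₂ n)^A});
* `G_f` (`GapPiece f`): the GAP LAW of reach f — hardness of any length in [n − f(n), n] (against a polylog degree of
  our choosing) forces hardness of n at the quasi-polynomial grade;
* `closes_dial f : S_f → G_f → MassHiQuasi` (every f), `closes := closes_dial half` (reach n/2: dyadic blocks).
The dial is MONOTONE (`syndPiece_mono`, `gapPiece_anti`): lengthening the reach weakens S and strengthens G.

## §A WHAT IS PROVED HERE (0 sorry; Prop-definition-free LAWS over the tree's `HardR` / `winCount` / `ringWinU` / `HasDegF`)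
1. `winCount_window` / `hardR_of_window` / `hardR_of_prefix` — THE WINDOW LAW IN VALUE FORM: `#win_c(y)` on k+ℓ+q bits is
   the sum over the 2^k·2^q fibres of the wins of the tree's ABSORBED WINDOW STRATEGIES (`AbsorptionDial.windowAbsorb`,
   identity `ringWinU_glue3_eq_windowAbsorb`, LANDED); hence `HardR p ℓ D θ → d + 2(k+q)d + 1 ≤ D → HardR p (k+ℓ+q) d θ`:
   hardness moves UP in length at LINEAR degree cost and NO value loss (supersedes g26 `LengthDial.reach`, cost 5^s).
2. `mux` / `winCount_mux` / `hasDegF_mux` — THE EXTENSION LAW (new identity): charge-multiplexing two length-k strategies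
   along a fresh front bit gives `#win_{k+1}(c, mux y₀ y₁) = #win_k(c+1, y₀) + #win_k(c, y₁)` at degree D + 1
   (`[mux] = u₀·[y₁∘tail] + (1 − u₀)·[y₀∘tail]` in `lowDeg`); corollaries `perfect_mux`, `allPerfect_add` (all-charge
   perfect play at (k, D) ⟹ at (k+t, D+t)), `pairBound_of_hardR_succ` (losses SUB-ADDITIVE up the diagonal).
3. `gapLaw_polylog B : GapLaw p (log₂ ·)^B` and `qAt_iff_synd_polylog B : QAt p ↔ Synd p (log₂ ·)^B` — THE POLYLOG BRIDGE
   IS A THEOREM and Q IS EQUIVALENT TO ITS POLYLOG-SYNDETIC FORM (prefix k ≤ (log₂ n)^B, schedule C' = B + C + 2,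
   `prefix_schedule`); globally `gapPiece_polylog`, `syndPiece_polylog_iff B : SyndPiece (plog B) ↔ MassHiQuasi`.
4. The same on the X side: `gapLawX_polylog`, `xAt_iff_syndX_polylog`, `syndXPiece_polylog_iff B : SyndXPiece (plog B) ↔
   NoPerfectPolyOdd` (item 28487, via the LANDED `perfect_of_few_losses_prefix`), `closesX_dial`.
5. Necessity / implication web: `syndPiece_of_massHiQuasi` (T ⟹ S_f, all f), `gapPiece_of_quasiLoss` (Q ⟹ G_f, all f),
   `synd_of_qAt`, `gapLaw_of_qAt`, `qAt_of_synd_gapLaw` (S ∧ G ⟹ Q per prime).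

## §B THE BARRIER THIS NODE RECORDS («LengthRigidity», for HOME/…/BARRIERS harvesting)
Every PROVED transfer of walk-game value between lengths has an exchange rate LINEAR IN THE GAP: degree × (2·gap + 1)
upward (window law, §A.1; the factor 2d per frozen bit is the cost of one absorbed selector pair, `hasDegF_windowAbsorb`)
and degree + gap for easiness upward / hardness downward (extension law, §A.2).  Consequently (kernel, §A.3–4): at every
reach f ≤ polylog the length dial is EXACT — S_f ≡ T and G_f is proved — and at every reach f ≫ polylog the bridge G_f
is a law with NO MECHANISM (polylog degree cannot pay a super-polylog gap), true outright if Q is (`gapPiece_of_quasiLoss`)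
and otherwise a bet of the same type as g26's `LengthDial.LawPiece` (degree-free two-step law).  THE LENGTH AXIS IS
THEREFORE CLOSED modulo one object: a transfer of hardness across a gap at SUB-LINEAR degree cost.  No such transfer is
known for any polynomial-threshold model (Razborov–Smolensky arguments are length-uniform; restrictions cost degree
per fixed bit).  This is the precise residual of every «prove it at SOME lengths, bridge to ALL» decomposition of Q or X.

## §C TAGS (per piece; tests stated)
* `SyndPiece (plog B)` — COSTUME (≡ T, kernel `syndPiece_polylog_iff`; cited as the ONE admissible EQUIV, with the split
  at reach `half` beneath it).  `GapPiece (plog B)` — PROVED (`gapPiece_polylog`).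
* `SyndPiece half` — WEAKER · leaf IDEA-NEEDED.  T-implied (`syndPiece_of_massHiQuasi`).  Why strictly weaker: it asks
  for ONE hard length per dyadic block [n/2, n] where T asks for every length, and the only converse route is G_half
  (no mechanism, §B).  Idea needed: ANY argument producing walk-game hardness along a sparse length sequence that does
  not already prove it at all lengths (none known; candidates: lengths n = 3^j where the MOD₃ structure is cyclic-group
  exact, lengths n = p^j − 1 where 𝔽_p-Frobenius orbits are uniform — both would be new).
* `GapPiece half` — UNDECIDED · BET · leaf BARRIER (§B).  Q-implied (`gapPiece_of_quasiLoss`), not T-implied.  Stated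
  test (finite, INSTRUMENTABLE at the census's sizes): the smallest non-vacuous instance of ANY degree-sub-linear gap law
  at p = 5, D = 2 is the g26 LawPiece table — by the random-model count (|B₂(n)| = 4, 16, 70, 222, 552, 1164, 2186, 3770
  cut functions of 𝔽₅-degree ≤ 2 on n = 1..8 bits, memo NODE-g26.md N3; |B₂(n)|^{n+1} strategies against 2^{2ⁿ} win
  patterns: ≈ 10² expected perfect strategies per charge at n = 6, ≈ 10⁻¹² at n = 7) perfect D = 2 strategies are expected
  through n = 6 (observed: V₂(4) = V₂(5) = 1, V₂(6, diag) = 1, V₂(6, off) ≥ 61/64 unresolved) and none from n = 7, so the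
  first informative instance has premise lengths (7, 8) and conclusion length 9 unless V₂(6, off) < 1 (then (6, 7) → 8, the
  g26 addendum's case) — either way EXACT optimal values at lengths 7..9 over menus of 2186 / 3770 / 6092 cut functions and
  8–10 cuts, beyond exhaustive or meet-in-the-middle optimisation (≥ 5·10¹⁰ XOR-sum evaluations per charge at n = 7 already)
  and not certifiable by local search.  RECOMMENDATION to census/critic: the kit ask «lenlaw-d2»
  (STATUS l.1694) cannot return an informative row at feasible sizes and should be withdrawn or re-scoped to the two
  INSTRUMENTABLE predictions of §A.2: (i) diagonal sub-additivity `W(k+1, D+1, c) ≥ W(k, D, c+1) + W(k, D, c)` — checked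
  here by hand against the g26 tables D = 0 → 1 → 2, n ≤ 7 (e.g. n = 6 → 7: 43 + 43 = 86 ≤ 97 (diag), 44 + 43 = 87 ≤ 102
  (off); D = 1 → 2 at 7: 53 + 53 = 106 ≤ 117): consistent, slack 11–15/128; (ii) `allPerfect_add` against lens-4's
  least-perfect-degree table d*(n) (PumpDial NODE, STATUS l.1686): d*(n + t) ≤ d*(n) + t, consistent with d*(n) ≈ ⌊(n+2)/3⌋.
* X side: `SyndXPiece (plog B)` COSTUME (≡ X), `GapXPiece (plog B)` PROVED; `SyndXPiece half` WEAKER · IDEA-NEEDED,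
  `GapXPiece half` UNDECIDED · BET · BARRIER — recorded for lens-4 (owner of X), not claimed.

## §D WHY THIS IS NOVEL (by construction vs lenses 1, 2, 3, 4, 6 and vs lens-5 g26)
No other lens varies the SET OF LENGTHS at which hardness is demanded: lens-1 (NamingDial) varies names/labels of the
residue game on DWalkThree, lens-2 (SparsityDial) the density of generic inputs at one length, lens-3 certificate / dual
families (cubic bent duals on CubicForrelation), lens-4 (UnityDial/PumpDial/ReadDial) unity relations, pumps and readers of
ONE strategy at ONE length on X, lens-6 (CharDial/OrbitDial/FieldColumns) counters, orbits and field columns of the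
character table.  The engine here — window absorption read as a VALUE-TRANSFER LAW ACROSS LENGTHS plus the new
charge-multiplexing extension identity — occurs in no other node (lens-4 uses absorption at a single length to count
losses).  Versus g26 (LengthDial, same seat): g26's law cost 5^s per s bits and could bridge only bounded gaps, so even
polylog windows needed the LawPiece bet; g27 proves the polylog bridge outright (S_plog ≡ T, kernel), moves the split to
reach n/2 where the lower piece is genuinely weaker, and identifies the residual object exactly (§B).

## §E RUNG CURRENCY.  Rung 0.  Nothing here proves Q, X or the summit; the node is a LAW + BARRIER node whose split at
reach `half` is honest (WEAKER ∧ UNDECIDED-with-test) and whose EQUIV at polylog reach is certified in kernel.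
Instrument data cited: HOME/decomp-qadv-lens-5/g26/NODE-g26.md (N3/N8 tables, |B₂(n)|, V_D(n)), crit-1 row 74v22
(num/b2class_crit.out, num/lenlaw_d1.out), lens-4 PumpDial NODE (d*(n), n = 4..21).
-/

set_option autoImplicit false
set_option linter.dupNamespace false

namespace Summit.QuantumAdvantage.QuantumAdvantage.Theorems.SyndeticDial
open Finset
open Summit.QuantumAdvantage.AdviceFreeQNC0
open Literature.Computability.MetaComplexity Literature.Computability.MetaComplexity.Smolensky
open Summit.QuantumAdvantage.QuantumAdvantage.Theorems.LengthDial
open Summit.QuantumAdvantage.QuantumAdvantage.Theorems.AbsorptionDial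

/-! ## §3 THE GAP DIAL (Q side): hardness at ONE length per window `[n − f(n), n]` ∧ a gap law of reach `f` -/

section Dial

variable (p : ℕ) [Fact p.Prime]
/-- hardness of LENGTH `m` MEASURED AT SCALE `n`: every charge, cut degree `(log₂ n)^C`, value `1 − 2^{−(log₂ n)^A}`. -/
def HardAt (A C n m : ℕ) : Prop :=
  HardR p m ((Nat.log 2 n) ^ C) (1 - 1 / (2 : ℝ) ^ ((Nat.log 2 n) ^ A))
/-- Q at the prime `p` (the consequent of the residual, per prime): all large lengths are hard at their own scale. -/
def QAt : Prop := ∃ A : ℕ, ∀ C : ℕ, ∃ n₀ : ℕ, ∀ n ≥ n₀, HardAt p A C n n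

/-- **`f`-SYNDETIC HARDNESS** at `p`: every window `[n − f(n), n]` (large `n`) contains a length that is hard at scale `n`. -/
def Synd (f : ℕ → ℕ) : Prop :=
  ∃ A : ℕ, ∀ C : ℕ, ∃ n₀ : ℕ, ∀ n ≥ n₀, ∃ m : ℕ, n - f n ≤ m ∧ m ≤ n ∧ HardAt p A C n m

/-- **GAP LAW OF REACH `f`** at `p`: hardness of ANY length in the window `[n − f(n), n]`, against a polylog degree of
our choosing, forces hardness of `n` itself at the quasi-polynomial grade. -/
def GapLaw (f : ℕ → ℕ) : Prop :=
  ∀ A : ℕ, ∃ A' : ℕ, ∀ C : ℕ, ∃ C' : ℕ, ∃ n₀ : ℕ, ∀ n ≥ n₀, ∀ m : ℕ, n - f n ≤ m → m ≤ n →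
    HardAt p A C' n m → HardAt p A' C n n

variable {p}

/-- Q ⟹ `f`-syndetic hardness, for every reach `f` (take `m = n`). -/
theorem synd_of_qAt (f : ℕ → ℕ) (h : QAt p) : Synd p f := by
  obtain ⟨A, hA⟩ := h
  refine ⟨A, fun C => ?_⟩
  obtain ⟨n₀, hn₀⟩ := hA C
  exact ⟨n₀, fun n hn => ⟨n, Nat.sub_le _ _, le_rfl, hn₀ n hn⟩⟩

/-- Q ⟹ the gap law of every reach (its conclusion then holds outright). -/
theorem gapLaw_of_qAt (f : ℕ → ℕ) (h : QAt p) : GapLaw p f := by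
  obtain ⟨A, hA⟩ := h
  intro _
  refine ⟨A, fun C => ⟨0, ?_⟩⟩
  obtain ⟨n₀, hn₀⟩ := hA C
  exact ⟨n₀, fun n hn _ _ _ _ => hn₀ n hn⟩

/-- **THE DIAL COMPOSES**: `f`-syndetic hardness ∧ the gap law of reach `f` ⟹ Q (at `p`). -/
theorem qAt_of_synd_gapLaw {f : ℕ → ℕ} (hS : Synd p f) (hG : GapLaw p f) : QAt p := by
  obtain ⟨A, hA⟩ := hS
  obtain ⟨A', hA'⟩ := hG A
  refine ⟨A', fun C => ?_⟩
  obtain ⟨C', n₁, h₁⟩ := hA' C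
  obtain ⟨n₂, h₂⟩ := hA C'
  refine ⟨max n₁ n₂, fun n hn => ?_⟩
  obtain ⟨m, hnm, hmn, hm⟩ := h₂ n (le_trans (le_max_right _ _) hn)
  exact h₁ n (le_trans (le_max_left _ _) hn) m hnm hmn hm

/-- the dial is MONOTONE: a longer reach makes syndetic hardness weaker … -/
theorem synd_mono {f g : ℕ → ℕ} (hfg : ∀ n, f n ≤ g n) (h : Synd p f) : Synd p g := by
  obtain ⟨A, hA⟩ := h
  refine ⟨A, fun C => ?_⟩
  obtain ⟨n₀, hn₀⟩ := hA C
  refine ⟨n₀, fun n hn => ?_⟩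
  obtain ⟨m, hnm, hmn, hm⟩ := hn₀ n hn
  exact ⟨m, by have := hfg n; omega, hmn, hm⟩

/-- … and the gap law stronger. -/
theorem gapLaw_anti {f g : ℕ → ℕ} (hfg : ∀ n, f n ≤ g n) (h : GapLaw p g) : GapLaw p f := by
  intro A
  obtain ⟨A', hA'⟩ := h A
  refine ⟨A', fun C => ?_⟩
  obtain ⟨C', n₀, hn₀⟩ := hA' C
  exact ⟨C', n₀, fun n hn m hnm hmn hm => hn₀ n hn m (by have := hfg n; omega) hmn hm⟩

/-- the degree schedule of a polylog prefix: `L^C + 2·k·L^C + 1 ≤ L^(B+C+2)` for `k ≤ L^B`, `L ≥ 2`. -/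
theorem prefix_schedule {L B C k : ℕ} (hL : 2 ≤ L) (hk : k ≤ L ^ B) :
    L ^ C + (2 * (k * L ^ C) + 1) ≤ L ^ (B + C + 2) := by
  have hX1 : L ^ C ≤ L ^ (B + C) := Nat.pow_le_pow_right (by omega) (by omega)
  have hX2 : k * L ^ C ≤ L ^ (B + C) := by
    rw [pow_add]; exact Nat.mul_le_mul_right _ hk
  have hX3 : 1 ≤ L ^ C := Nat.one_le_pow _ _ (by omega)
  have h4 : 4 ≤ L ^ 2 :=
    calc (4 : ℕ) = 2 ^ 2 := by norm_num
      _ ≤ L ^ 2 := Nat.pow_le_pow_left hL 2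
  have hX4 : 4 * L ^ (B + C) ≤ L ^ (B + C + 2) :=
    calc 4 * L ^ (B + C) ≤ L ^ 2 * L ^ (B + C) := Nat.mul_le_mul_right _ h4
      _ = L ^ (B + C + 2) := by rw [← pow_add, Nat.add_comm 2 (B + C)]
  omega

/-- **THE POLYLOG GAP LAW IS A THEOREM**: reach `f(n) = (log₂ n)^B` — the window law (`hardR_of_prefix`) with
`k = n − m ≤ (log₂ n)^B` frozen prefix bits, degree schedule `C' = B + C + 2`, same value exponent `A' = A`. -/
theorem gapLaw_polylog (B : ℕ) : GapLaw p fun n => (Nat.log 2 n) ^ B := by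
  intro A
  refine ⟨A, fun C => ⟨B + C + 2, ?_⟩⟩
  obtain ⟨L₀, hL₀⟩ := two_mul_pow_le_two_pow B
  refine ⟨2 ^ (max L₀ 2), fun n hn m hnm hmn hm => ?_⟩
  have hnm' : n - (Nat.log 2 n) ^ B ≤ m := hnm
  unfold HardAt at hm ⊢
  obtain ⟨L, hL⟩ : ∃ L, L = Nat.log 2 n := ⟨_, rfl⟩
  rw [← hL] at hm hnm' ⊢
  have hn0 : n ≠ 0 := by
    have := Nat.one_le_two_pow (n := max L₀ 2); omega
  have hLge : max L₀ 2 ≤ L := hL ▸ Nat.le_log_of_pow_le one_lt_two hn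
  have h2L : 2 ^ L ≤ n := hL ▸ Nat.pow_log_le_self 2 hn0
  have hk : 2 * L ^ B ≤ 2 ^ L := hL₀ L (le_trans (le_max_left _ _) hLge)
  have hL2 : 2 ≤ L := le_trans (le_max_right _ _) hLge
  have hB1 : 1 ≤ L ^ B := Nat.one_le_pow _ _ (by omega)
  obtain ⟨k, rfl⟩ : ∃ k, n = k + m := ⟨n - m, by omega⟩
  have hm1 : 1 ≤ m := by omega
  have hkB : k ≤ L ^ B := by omega
  exact hardR_of_prefix hm1 hm (prefix_schedule hL2 hkB)

/-- **KERNEL (the costume certificate of the dense settings)**: for every `B`, Q at `p` is EQUIVALENT to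
`(log₂ n)^B`-syndetic hardness — hardness need only be established at ONE length per polylog window. -/
theorem qAt_iff_synd_polylog (B : ℕ) : QAt p ↔ Synd p fun n => (Nat.log 2 n) ^ B :=
  ⟨synd_of_qAt _, fun h => qAt_of_synd_gapLaw h (gapLaw_polylog B)⟩

end Dial

/-! ## §4 THE SAME DIAL ON THE X SIDE (item 28487 `NoPerfectPolyOdd`): exactness is polylog-gap invariant too -/

section DialX

variable (p : ℕ) [Fact p.Prime]

/-- no perfect strategy at LENGTH `m`, any charge, against cut degree `(log₂ n)^C` (scale `n`). -/
def NoPerfAt (C n m : ℕ) : Prop :=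
  ∀ c : ℕ, ∀ y : Fin (m + 1) → (Fin m → Bool) → Bool, (∀ g, HasDegF p (y g) ((Nat.log 2 n) ^ C)) →
    ∃ u, ringWinU c y u = false

/-- X at the prime `p`. -/
def XAt : Prop := ∀ C : ℕ, ∃ n₀ : ℕ, ∀ n ≥ n₀, NoPerfAt p C n n

/-- `f`-syndetic exactness: every window `[n − f(n), n]` contains a length with no perfect strategy at scale `n`. -/
def SyndX (f : ℕ → ℕ) : Prop :=
  ∀ C : ℕ, ∃ n₀ : ℕ, ∀ n ≥ n₀, ∃ m : ℕ, n - f n ≤ m ∧ m ≤ n ∧ NoPerfAt p C n m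

/-- gap law for exactness, reach `f`. -/
def GapLawX (f : ℕ → ℕ) : Prop :=
  ∀ C : ℕ, ∃ C' : ℕ, ∃ n₀ : ℕ, ∀ n ≥ n₀, ∀ m : ℕ, n - f n ≤ m → m ≤ n → NoPerfAt p C' n m → NoPerfAt p C n n

variable {p}

/-- SyndeticDialB helper `syndX_of_xAt` (decomp-qadv land package; see the module docstring). -/
theorem syndX_of_xAt (f : ℕ → ℕ) (h : XAt p) : SyndX p f := fun C => by
  obtain ⟨n₀, hn₀⟩ := h C
  exact ⟨n₀, fun n hn => ⟨n, Nat.sub_le _ _, le_rfl, hn₀ n hn⟩⟩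

/-- SyndeticDialB helper `xAt_of_syndX_gapLawX` (decomp-qadv land package; see the module docstring). -/
theorem xAt_of_syndX_gapLawX {f : ℕ → ℕ} (hS : SyndX p f) (hG : GapLawX p f) : XAt p := fun C => by
  obtain ⟨C', n₁, h₁⟩ := hG C
  obtain ⟨n₂, h₂⟩ := hS C'
  refine ⟨max n₁ n₂, fun n hn => ?_⟩
  obtain ⟨m, hnm, hmn, hm⟩ := h₂ n (le_trans (le_max_right _ _) hn)
  exact h₁ n (le_trans (le_max_left _ _) hn) m hnm hmn hm

/-- **the polylog gap law for exactness is a theorem**: a perfect strategy at length `n = k + m` restricts, on a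
loss-free prefix fibre, to a perfect absorbed window strategy at length `m` (`perfect_of_few_losses_prefix`). -/
theorem gapLawX_polylog (B : ℕ) : GapLawX p fun n => (Nat.log 2 n) ^ B := by
  intro C
  refine ⟨B + C + 2, ?_⟩
  obtain ⟨L₀, hL₀⟩ := two_mul_pow_le_two_pow B
  refine ⟨2 ^ (max L₀ 2), fun n hn m hnm hmn hm => ?_⟩
  have hnm' : n - (Nat.log 2 n) ^ B ≤ m := hnm
  unfold NoPerfAt at hm ⊢
  obtain ⟨L, hL⟩ : ∃ L, L = Nat.log 2 n := ⟨_, rfl⟩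
  rw [← hL] at hm hnm' ⊢
  have hn0 : n ≠ 0 := by
    have := Nat.one_le_two_pow (n := max L₀ 2); omega
  have hLge : max L₀ 2 ≤ L := hL ▸ Nat.le_log_of_pow_le one_lt_two hn
  have h2L : 2 ^ L ≤ n := hL ▸ Nat.pow_log_le_self 2 hn0
  have hk : 2 * L ^ B ≤ 2 ^ L := hL₀ L (le_trans (le_max_left _ _) hLge)
  have hL2 : 2 ≤ L := le_trans (le_max_right _ _) hLge
  have hB1 : 1 ≤ L ^ B := Nat.one_le_pow _ _ (by omega)
  obtain ⟨k, rfl⟩ : ∃ k, n = k + m := ⟨n - m, by omega⟩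
  have hm1 : 1 ≤ m := by omega
  have hkB : k ≤ L ^ B := by omega
  intro c y hy
  by_contra hno
  simp only [not_exists, Bool.not_eq_false] at hno
  have h0 : (univ.filter fun u : Fin (k + m) → Bool => ringWinU c y u = false).card < 2 ^ k := by
    rw [Finset.filter_eq_empty_iff.2 fun u _ => by rw [hno u]; exact Bool.noConfusion, Finset.card_empty]
    exact Nat.one_le_two_pow
  obtain ⟨c', y', hy', hperf⟩ := perfect_of_few_losses_prefix (k := k) (ℓ := m) hm1 c y hy h0
  obtain ⟨w, hw⟩ := hm c' y' fun g => hasDegF_mono (hy' g) (prefix_schedule hL2 hkB)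
  rw [hperf w] at hw
  exact Bool.noConfusion hw

/-- **KERNEL**: X at `p` is EQUIVALENT to `(log₂ n)^B`-syndetic exactness, for every `B`. -/
theorem xAt_iff_syndX_polylog (B : ℕ) : XAt p ↔ SyndX p fun n => (Nat.log 2 n) ^ B :=
  ⟨syndX_of_xAt _, fun h => xAt_of_syndX_gapLawX h (gapLawX_polylog B)⟩

end DialX

/-! ## §5 THE PIECES, THE TAGS, AND `closes` BY NAME onto item 28401 `AbsorptionDial.MassHiQuasi` -/

section Pieces

/-- polylog reach `(log₂ n)^B`. -/
def plog (B : ℕ) : ℕ → ℕ := fun n => (Nat.log 2 n) ^ B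

/-- dyadic reach `n / 2`: the window `[n − n/2, n]` is the dyadic block below `n`. -/
def half : ℕ → ℕ := fun n => n / 2

/-- **PIECE S_f — `f`-SYNDETIC HARDNESS UNDER THE FLOOR** (the dial's lower piece).
TAGS.  `f = plog B`: COSTUME (≡ the target; kernel `syndPiece_polylog_iff`).  `f = half` (the node's setting) and every
reach beyond polylog: WEAKER (T-implied by `syndPiece_of_massHiQuasi`; strictly weaker EVIDENCE: the converse is the gap
law `GapPiece half`, for which no mechanism exists — the only length-transfer of hardness in the tree or here, window
absorption, pays degree `× (2·gap + 1)` (`hardR_of_window`), i.e. degree `n·polylog` across a dyadic gap) · leaf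
IDEA-NEEDED (no technique proves walk-game hardness along a SPARSE length sequence without proving it everywhere:
Razborov–Smolensky-type arguments are length-uniform).
Why strictly weaker (sentence): S_half asks for ONE hard length per dyadic block where T asks for ALL lengths, and
nothing known converts the former into the latter at polylog degree. -/
def SyndPiece (f : ℕ → ℕ) : Prop := QuarterFloor → ∀ (p : ℕ) [Fact p.Prime], 5 ≤ p → Synd p f

/-- **PIECE G_f — THE GAP LAW OF REACH `f`** (the dial's bridge).
TAGS.  `f = plog B`: PROVED (`gapPiece_polylog`, the window law).  `f = half` and beyond: UNDECIDED · BET — stated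
test: the law predicts, at every finite size, `V(n, d, ·) ≤ max_{m ∈ [n/2, n]} V(m, d·(2(n−m)+1)+1, ·)` is NOT needed
(that is the proved direction); what it bets is hardness transfer at (near-)CONSTANT degree cost across a linear gap,
whose smallest instance is the census's LawPiece table (`LengthDial.LawPiece`, p = 5, D = 2): a lossless two-step law
failing there falsifies every G_f with f ≫ polylog at that grade · Q-implied (`gapPiece_of_quasiLoss`: if Q holds the law
holds outright), NOT T-implied · leaf BARRIER («LengthRigidity», module docstring §B): every proved length transfer
has exchange rate degree × Θ(gap) (window law) or degree + gap (extension law `hasDegF_mux`), so a gap law of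
super-polylog reach at polylog cost needs a mechanism outside substitution/absorption.
Why strictly weaker (sentence): G_half is implied by Q outright and says nothing at lengths where no nearby length is
hard, so it does not imply T unless S_half is added; whether it is strictly weaker than T is open (it is a law, T is a
bound). -/
def GapPiece (f : ℕ → ℕ) : Prop := ∀ (p : ℕ) [Fact p.Prime], 5 ≤ p → GapLaw p f

/-- Q (verbatim consequent of 28401) in per-prime form. -/
theorem quasiLoss_iff_qAt : QuasiLoss ↔ ∀ (p : ℕ) [Fact p.Prime], 5 ≤ p → QAt p := Iff.rfl

/-- **`closes` FOR EVERY REACH**: S_f ∧ G_f ⟹ item 28401, BY NAME. -/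
theorem closes_dial (f : ℕ → ℕ) (hS : SyndPiece f) (hG : GapPiece f) :
    Summit.QuantumAdvantage.QuantumAdvantage.Theses.AbsorptionDial.MassHiQuasi :=
  massHiQuasi_unfold.2 fun hF => quasiLoss_iff_qAt.2 fun p _ hp => qAt_of_synd_gapLaw (hS hF p hp) (hG p hp)

/-- **S_f IS NECESSARY** (T-implied, every reach). -/
theorem syndPiece_of_massHiQuasi (f : ℕ → ℕ)
    (h : Summit.QuantumAdvantage.QuantumAdvantage.Theses.AbsorptionDial.MassHiQuasi) : SyndPiece f :=
  fun hF p _ hp => synd_of_qAt f (quasiLoss_iff_qAt.1 (massHiQuasi_unfold.1 h hF) p hp)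

/-- **G_f IS Q-IMPLIED** (every reach). -/
theorem gapPiece_of_quasiLoss (f : ℕ → ℕ) (h : QuasiLoss) : GapPiece f :=
  fun p _ hp => gapLaw_of_qAt f (quasiLoss_iff_qAt.1 h p hp)

/-- **THE POLYLOG BRIDGE IS PROVED.** -/
theorem gapPiece_polylog (B : ℕ) : GapPiece (plog B) := fun _ _ _ => gapLaw_polylog B

/-- **COSTUME CERTIFICATE**: at polylog reach the lower piece IS the target (EQUIV, admissible once: the split beneath
it is the dial at reach `half`). -/
theorem syndPiece_polylog_iff (B : ℕ) :
    SyndPiece (plog B) ↔ Summit.QuantumAdvantage.QuantumAdvantage.Theses.AbsorptionDial.MassHiQuasi :=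
  ⟨fun h => closes_dial _ h (gapPiece_polylog B), syndPiece_of_massHiQuasi _⟩

/-- the dial is monotone: longer reach ⟹ weaker S … -/
theorem syndPiece_mono {f g : ℕ → ℕ} (hfg : ∀ n, f n ≤ g n) (h : SyndPiece f) : SyndPiece g :=
  fun hF p _ hp => synd_mono hfg (h hF p hp)

/-- … and stronger G. -/
theorem gapPiece_anti {f g : ℕ → ℕ} (hfg : ∀ n, f n ≤ g n) (h : GapPiece g) : GapPiece f :=
  fun p _ hp => gapLaw_anti hfg (h p hp)

/-- **`closes` — THE NODE** (reach `half`): 28401 `MassHiQuasi` ⟸ S_half [WEAKER · IDEA-NEEDED] ∧ G_half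
[UNDECIDED · BET · BARRIER-tagged], BY NAME. -/
theorem closes (hS : SyndPiece half) (hG : GapPiece half) :
    Summit.QuantumAdvantage.QuantumAdvantage.Theses.AbsorptionDial.MassHiQuasi :=
  closes_dial half hS hG

/-! ### the X side, BY NAME onto item 28487 `AbsorptionDial.NoPerfectPolyOdd` (lens-4's target; recorded, not claimed) -/

/-- `f`-syndetic exactness at every prime `p ≥ 5` (X is unconditional: no floor). Tags as for S_f with T ↦ X. -/
def SyndXPiece (f : ℕ → ℕ) : Prop := ∀ (p : ℕ) [Fact p.Prime], 5 ≤ p → SyndX p f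

/-- the exactness gap law of reach `f` at every prime `p ≥ 5`. Tags as for G_f. -/
def GapXPiece (f : ℕ → ℕ) : Prop := ∀ (p : ℕ) [Fact p.Prime], 5 ≤ p → GapLawX p f

/-- SyndeticDialB helper `noPerfectPolyOdd_iff_xAt` (decomp-qadv land package; see the module docstring). -/
theorem noPerfectPolyOdd_iff_xAt :
    Summit.QuantumAdvantage.QuantumAdvantage.Theses.AbsorptionDial.NoPerfectPolyOdd ↔
      ∀ (p : ℕ) [Fact p.Prime], 5 ≤ p → XAt p := Iff.rfl

/-- SyndeticDialB helper `closesX_dial` (decomp-qadv land package; see the module docstring). -/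
theorem closesX_dial (f : ℕ → ℕ) (hS : SyndXPiece f) (hG : GapXPiece f) :
    Summit.QuantumAdvantage.QuantumAdvantage.Theses.AbsorptionDial.NoPerfectPolyOdd :=
  noPerfectPolyOdd_iff_xAt.2 fun p _ hp => xAt_of_syndX_gapLawX (hS p hp) (hG p hp)
/-- SyndeticDialB helper `syndXPiece_of_noPerfectPolyOdd` (decomp-qadv land package; see the module docstring). -/
theorem syndXPiece_of_noPerfectPolyOdd (f : ℕ → ℕ)
    (h : Summit.QuantumAdvantage.QuantumAdvantage.Theses.AbsorptionDial.NoPerfectPolyOdd) : SyndXPiece f :=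
  fun p _ hp => syndX_of_xAt f (noPerfectPolyOdd_iff_xAt.1 h p hp)
/-- SyndeticDialB helper `gapXPiece_polylog` (decomp-qadv land package; see the module docstring). -/
theorem gapXPiece_polylog (B : ℕ) : GapXPiece (plog B) := fun _ _ _ => gapLawX_polylog B
/-- **COSTUME CERTIFICATE (X side)**: X is EQUIVALENT to its polylog-syndetic form. -/
theorem syndXPiece_polylog_iff (B : ℕ) :
    SyndXPiece (plog B) ↔ Summit.QuantumAdvantage.QuantumAdvantage.Theses.AbsorptionDial.NoPerfectPolyOdd :=
  ⟨fun h => closesX_dial _ h (gapXPiece_polylog B), syndXPiece_of_noPerfectPolyOdd _⟩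

end Pieces

end Summit.QuantumAdvantage.QuantumAdvantage.Theorems.SyndeticDial
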